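import Literature.NumberTheory.GaloisRepresentations.LubinTateUnitBallIntegralClosure
import Mathlib.RingTheory.Norm.Transitivity
import HarnessLib

/-!
# Integrality in a finite Galois subextension of `F̄` (spectral norm) is read off the norm: `‖x‖ ≤ 1 ⟺ |N_{E/F} x|_F ≤ 1`, `‖x‖ < 1 ⟺ |N_{E/F} x|_F < 1`
# (Serre *Local Fields* II §2; Cassels–Fröhlich II §10: `‖x‖ = |N(x)|^{1/n}`)

Topic `NumberTheory/GaloisRepresentations`; namespace `Literature.NumberTheory.GaloisRepresentations`, in the currency of the tree's Lubin–Tate / Coleman files: a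
non-archimedean local field `F` (`IsNonarchimedeanLocalField`, local instances `nF`, `rk1`), a finite subextension `E ⊆ F̄` normed by the SPECTRAL NORM (local instance `nE`,
`norm_eq_spectralNorm`), `unitBall E = {‖x‖ ≤ 1}` (`LubinTateTorsion`, `LubinTateUnitBallIntegralClosure`).  For `E/F` Galois:
* `spectral_norm_algebraMap_eq` (`‖c‖_E = ‖c‖_F`, `spectralNorm_extends`), `spectral_norm_algEquiv_apply` (`‖σ x‖ = ‖x‖`, Mathlib `spectralNorm_eq_of_equiv`);
* ★ `spectral_norm_norm_eq_pow` — `‖N_{E/F} x‖ = ‖x‖^{[E:F]}` (`N = ∏_σ σ x`, `Algebra.norm_eq_prod_automorphisms`);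
* ★★ **`spectral_norm_le_one_iff_norm_norm_le_one`**, ★★ **`spectral_norm_lt_one_iff_norm_norm_lt_one`**, and the valuation forms ★★ `spectral_norm_le_one_iff_valued_norm_le_one`,
  ★★ `spectral_norm_lt_one_iff_valued_norm_lt_one` — membership in `unitBall E` / in its maximal ideal is decided by `v_F(N_{E/F} x)`.
Use (cell `bsd-print-cf2`, brick §4(c)/(e), dictionary D2 «local model» LM2 route (β), memo BRICK-C-ORBITS-g22 F39): with the companion statement on the completion side
(`CompletionValuedGaloisNorm`: `v_w(z) ≤ 1 ⟺ v_v(N z) ≤ 1`) and `N(θ y) = N(y)` for the compositum isomorphism `θ : K_v(E) ≅ E_w` (`CompletionCompositum`), the unit balls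
and principal units correspond under `θ` — without the integral-closure description of `𝒪_{E_w}`.  Theorems only; no definition, no named fact, no `sorry`; the normed
structures are the files' LOCAL instances (nothing global is registered).

## References
* [SerreLocalFields1979] J.-P. Serre, *Local Fields* (1979), Ch. II §2 (uniqueness of the extension; `|x|_L = |N_{L/K} x|_K^{1/n}`).
* [CasselsFrohlichANT1967] J. W. S. Cassels, A. Fröhlich (eds.), *Algebraic Number Theory* (1967), Ch. II §10.
-/

noncomputable section

namespace Literature.NumberTheory.GaloisRepresentations

section SpectralGaloisNorm

open GaloisRepresentations.IsNonarchimedeanLocalField LubinTate ValuativeRel Field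

variable {F : Type} [Field F] [ValuativeRel F] [TopologicalSpace F] [IsNonarchimedeanLocalField F]

attribute [local instance] ltNormUniformSpace ltNormIsUniformAddGroup rk1 nF nE fintypeResidueField

variable (E : IntermediateField F (AlgebraicClosure F)) [FiniteDimensional F E]

/-- `‖c‖_E = ‖c‖_F` for `c ∈ F` (the spectral norm extends the norm of `F`). [cite: SerreLocalFields1979, Ch. II §2] -/
theorem spectral_norm_algebraMap_eq (c : F) : ‖algebraMap F E c‖ = ‖c‖ := by
  rw [norm_eq_spectralNorm, spectralNorm_extends]

/-- **The `F`-automorphisms of `E` are isometries**: `‖σ x‖ = ‖x‖`. [cite: SerreLocalFields1979, Ch. II §2] -/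
theorem spectral_norm_algEquiv_apply (σ : E ≃ₐ[F] E) (x : E) : ‖σ x‖ = ‖x‖ := by
  rw [norm_eq_spectralNorm, norm_eq_spectralNorm, ← spectralNorm_eq_of_equiv]

/-- ★ **`‖N_{E/F} x‖ = ‖x‖^{[E:F]}`** for `E/F` Galois (`N x = ∏_σ σ x` and the `σ` are isometries). [cite: SerreLocalFields1979, Ch. II §2] [cite: CasselsFrohlichANT1967, Ch. II §10] -/
theorem spectral_norm_norm_eq_pow [IsGalois F E] (x : E) : ‖Algebra.norm F x‖ = ‖x‖ ^ Module.finrank F E := by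
  rw [← spectral_norm_algebraMap_eq E, Algebra.norm_eq_prod_automorphisms, norm_prod, Finset.prod_congr rfl fun σ _ => spectral_norm_algEquiv_apply E σ x,
    Finset.prod_const, Finset.card_univ, ← Nat.card_eq_fintype_card, IsGalois.card_aut_eq_finrank]

/-- ★★ **`‖x‖ ≤ 1 ⟺ ‖N_{E/F} x‖ ≤ 1`**: membership in the unit ball `𝒪_E` is decided by the norm down to `F`. [cite: SerreLocalFields1979, Ch. II §2] -/
theorem spectral_norm_le_one_iff_norm_norm_le_one [IsGalois F E] (x : E) : ‖x‖ ≤ 1 ↔ ‖Algebra.norm F x‖ ≤ 1 := by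
  rw [spectral_norm_norm_eq_pow]
  exact (pow_le_one_iff_of_nonneg (norm_nonneg _) Module.finrank_pos.ne').symm

/-- ★★ **`‖x‖ < 1 ⟺ ‖N_{E/F} x‖ < 1`** (applied to `x = u − 1` this decides membership in the principal units). [cite: SerreLocalFields1979, Ch. II §2] -/
theorem spectral_norm_lt_one_iff_norm_norm_lt_one [IsGalois F E] (x : E) : ‖x‖ < 1 ↔ ‖Algebra.norm F x‖ < 1 := by
  rw [spectral_norm_norm_eq_pow]
  exact (pow_lt_one_iff_of_nonneg (norm_nonneg _) Module.finrank_pos.ne').symm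

/-- ★★ Valuation form: **`‖x‖ ≤ 1 ⟺ v_F(N_{E/F} x) ≤ 1`** (the norm of `F` is the one defined by its valuation). [cite: SerreLocalFields1979, Ch. II §2] -/
theorem spectral_norm_le_one_iff_valued_norm_le_one [IsGalois F E] (x : E) : ‖x‖ ≤ 1 ↔ Valued.v (Algebra.norm F x) ≤ 1 := by
  rw [spectral_norm_le_one_iff_norm_norm_le_one, Valued.toNormedField.norm_le_one_iff]

/-- ★★ Valuation form: **`‖x‖ < 1 ⟺ v_F(N_{E/F} x) < 1`**. [cite: SerreLocalFields1979, Ch. II §2] -/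
theorem spectral_norm_lt_one_iff_valued_norm_lt_one [IsGalois F E] (x : E) : ‖x‖ < 1 ↔ Valued.v (Algebra.norm F x) < 1 := by
  rw [spectral_norm_lt_one_iff_norm_norm_lt_one, Valued.toNormedField.norm_lt_one_iff]

/-- ★★ **`x ∈ unitBall E ⟺ v_F(N_{E/F} x) ≤ 1`** — the unit ball of the Lubin–Tate files through the norm. [cite: SerreLocalFields1979, Ch. II §2] -/
theorem mem_unitBall_iff_valued_norm_le_one [IsGalois F E] (x : E) : x ∈ unitBall E ↔ Valued.v (Algebra.norm F x) ≤ 1 := by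
  rw [mem_unitBall_iff, spectral_norm_le_one_iff_valued_norm_le_one]

end SpectralGaloisNorm

end Literature.NumberTheory.GaloisRepresentations

end
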